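import Summits.BirchSwinnertonDyer.BirchSwinnertonDyer.Theorems.AlignedTransportAtTwoMainConjectureTransportAlignedAtTwoKilfordCopySymmetricSocle
import Summits.BirchSwinnertonDyer.Rank1Residual.F1Sign2.CopyAlignmentAtTwo
import HarnessLib

/-!
# Crux C1 `MainConjectureTransportAlignedAtTwo` (stmt-BirchSwinnertonDyer-22296), line `birth`, residual (R2) `stub_lamLawKilford` (Kilford stratum):
# THE MULTIPLICATIVE LINE OF A COPY — H12♯ at multiplicity two: every copy of `ρ̄` meets the multiplicative part in EXACTLY ONE line,
# distinct copies in distinct lines, hence «ALIGNED AT 2 ⟺ SAME COPY» (width seat att-p3 g17; `--supports 22296`; part 2 of 2)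

THEOREMS ONLY (no `def`, no `sorry`, no named fact); pure linear algebra over `𝔽₂`, kernel-checked. BSD is not proved by this; C1 is not
closed by this; the cell's candidate `F1Sign2.CopyAlignmentAtTwo` is NOT proved by this — what this file proves is the DEDUCTION
«`CopyAlignmentAtTwo` ⟸ MULT2 + (W0) + (W1) + (W3)» of MEMO-imc §10.24 (c) in abstract form, so that CA's open content is exactly
the three carrier statements ((W0) the canonical subgroup of a modular elliptic curve lands in the multiplicative part of `J₀(N)[2]`;
(W1) Wiese 2007 Cor. 4.2 for `J₀(N)` at composite `N` = REF1's gap (γ); (W3) the `w_N`-twisted Weil pairing) and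
`F1Sign2.MultiplicityTwoOnStratumAtTwo` (Kilford–Wiese Question 1.9). Setting and part 1: `…KilfordCopySymmetricSocle.lean`.

RESULTS.
* §4 **`exists_forall_mem_iff_eq_zero_or_eq_mulVec`** (H12♯ at `r = 2`): with (W1) read as «`M₀ ⊆ V` has `8` elements, each
  `τ m₀` for a socle-type `τ`» there is an INVERTIBLE `A ∈ GL₂(𝔽₂)` with: for `u ∈ U` in a copy, `Ψ u = a·wᵀ` (`w ≠ 0`),
  `u ∈ M₀ ⟺ a = 0 ∨ a = A w`. Proof: part 1 §3 gives `Ψ(M₀) ⊆ A·Sym₂(𝔽₂)`, `A = J·Y(m₀)`; counting (`#M₀ = 8 = #𝔽₂³`) forces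
  equality and the invertibility of `A`; then `F1Sign2.vecMulVec_isSymm_iff_fin_two`.
* §5 `exists_forall_map_eq_vecMulVec` (Schur for `ρ̄`: a `π/ρ`-equivariant `ψ : 𝔽₂² → U` reads `a ↦ a·wᵀ` through `Ψ`);
  **`range_eq_range_iff_eq_of_mem`** («ALIGNED AT 2 ⟺ SAME COPY»: two equivariant embeddings `ψ₁ ψ₂ : 𝔽₂² → U` with canonical
  vectors `cᵢ ≠ 0`, `ψᵢ cᵢ ∈ M₀` (W0) have the same image iff `c₁ = c₂`); `existsUnique_ne_zero_and_mem` (each copy meets `M₀` in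
  exactly one line).
DICTIONARY for the consumer (CA): `V = J₀(N)[2]_𝔪 ⊂ J0.tors N` with the Galois action of a `ModularJacobianGaloisData`, `U = J₀(N)[𝔪_f]`
(`F1Sign2.modTwoHeckeIdeal`), the copies `F1Sign2.twoTorsionCopy fᵢ = range ψᵢ`, `ρ̄` = the common `E₁[2] ≅ E₂[2]` through the shared
cubic field (`…SharedCubicTorsion`), `cᵢ` = the canonical point (`AlignedAtTwo` ⟺ `c₁ = c₂`, MEMO-imc §10.24 (a)), `B = e₂(·, w_N ·)`,
`M₀ = G⁰[2] ∩ J₀(N)[𝔪]`, `τ ∈ soc(𝕋_𝔪/2)`.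

References (for the reading, not used in the proofs): [Wiese2007Multiplicities, Prop. 2.2, Cor. 4.2]; [KilfordWiese2008, Prop. 2.6,
Question 1.9]; [Gross1990, p. 485].
-/

set_option autoImplicit false

noncomputable section

-- justification: the `Summit.BirchSwinnertonDyer.BirchSwinnertonDyer.…` path repeats a component (route-file convention)
set_option linter.dupNamespace false

open Matrix
open Summit.BirchSwinnertonDyer.BirchSwinnertonDyer.Theorems.AlignedTransportAtTwoKilfordCopySymmetricSocle

namespace Summit.BirchSwinnertonDyer.BirchSwinnertonDyer.Theorems.AlignedTransportAtTwoKilfordCopyMultiplicativeLine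

/-! ## §4 The multiplicative part at multiplicity two: `Ψ(M₀) = A · Sym₂(𝔽₂)`, every copy meets `M₀` in ONE line -/

section Main

variable {V : Type*} [AddCommGroup V] [Module (ZMod 2) V] [FiniteDimensional (ZMod 2) V] {G : Type*} [Group G]

/-- **H12♯ at multiplicity two (the symmetric-socle theorem).** Setting (all over `𝔽₂`): `π` a representation of `G` on the
finite-dimensional `V` (plays `J₀(N)[2]_𝔪` with its Galois action); `ρ : G → M₂(𝔽₂)` multiplicative with the swap
`!![0,1;1,0]` and the shear `!![1,1;0,1]` in its range (plays `ρ̄ = E[2]` with image `GL₂(𝔽₂) ≅ S₃`); `U ≤ V` `π`-stable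
(plays `J₀(N)[𝔪]`); `Ψ : V → M₂(𝔽₂)` linear, injective on `U` with `Ψ(U) = M₂(𝔽₂)` and `Ψ(π g u) = ρ g · Ψ u` (plays
MULTIPLICITY TWO: `J₀(N)[𝔪] ≅ ρ̄ ⊗ W`, `dim W = 2`, columns = `ρ̄`); `B` a nondegenerate SYMMETRIC `π`-invariant bilinear
form (plays the `w_N`-twisted Weil pairing, Hecke-self-adjoint — (W3)); `M₀ ⊆ V` a set of `8` vectors each of the form
`τ m₀` for a socle-type `τ` (linear, image in `U`, `B`-self-adjoint, `π`-equivariant) (plays (W1): the `𝔪`-torsion of the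
multiplicative part `G⁰[2] ≅ T̄·x₀`, `= soc(T̄)·x₀` of dimension `2r − 1 = 3`, Wiese 2007 Cor. 4.2). CONCLUSION: there is an
invertible `A ∈ GL₂(𝔽₂)` such that for every `u ∈ U` lying in a copy, `Ψ u = a·wᵀ` (`w ≠ 0`): `u ∈ M₀ ⟺ a = 0 ∨ a = A w` —
every copy `Ψ⁻¹{ρ̄·wᵀ}` meets `M₀` in EXACTLY the line `{0, Ψ⁻¹((Aw)·wᵀ)}`, and distinct copies in distinct lines. Proof:
§3 gives `Ψ(M₀) ⊆ {A·S : S symmetric}` with `A = J·Y(m₀)`; `#M₀ = 8 = #Sym₂(𝔽₂)` forces equality and `A` invertible; then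
the cell's `F1Sign2.vecMulVec_isSymm_iff_fin_two` (`a·wᵀ` symmetric iff `a ∈ {0, w}`). MEMO-imc §10.24 (c) «H12♯», there an
observation on paper; REF1-AUDIT §34. [folklore] -/
theorem exists_forall_mem_iff_eq_zero_or_eq_mulVec (π : Representation (ZMod 2) G V)
    (ρ : G →* Matrix (Fin 2) (Fin 2) (ZMod 2)) {gs gt : G} (hgs : ρ gs = !![0, 1; 1, 0]) (hgt : ρ gt = !![1, 1; 0, 1])
    (U : Submodule (ZMod 2) V) (hπU : ∀ g, ∀ u ∈ U, π g u ∈ U)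
    (Ψ : V →ₗ[ZMod 2] Matrix (Fin 2) (Fin 2) (ZMod 2)) (hΨinj : ∀ u ∈ U, Ψ u = 0 → u = 0)
    (hΨsurj : ∀ X, ∃ u ∈ U, Ψ u = X) (hΨπ : ∀ g, ∀ u ∈ U, Ψ (π g u) = ρ g * Ψ u)
    (B : LinearMap.BilinForm (ZMod 2) V) (hB : B.Nondegenerate) (hBsymm : ∀ x y, B x y = B y x)
    (hBπ : ∀ g x y, B (π g x) (π g y) = B x y)
    (M₀ : Set V) (m₀ : V) (hcard : M₀.ncard = 8)
    (hM₀ : ∀ x ∈ M₀, ∃ τ : V →ₗ[ZMod 2] V, (∀ v, τ v ∈ U) ∧ (∀ x y, B (τ x) y = B x (τ y)) ∧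
      (∀ g v, τ (π g v) = π g (τ v)) ∧ τ m₀ = x) :
    ∃ A A' : Matrix (Fin 2) (Fin 2) (ZMod 2), A * A' = 1 ∧ A' * A = 1 ∧
      ∀ u ∈ U, ∀ a w : Fin 2 → ZMod 2, w ≠ 0 → Ψ u = vecMulVec a w → (u ∈ M₀ ↔ a = 0 ∨ a = A *ᵥ w) := by
  classical
  -- preimages of the elementary matrices
  choose pre hpreU hpre using fun i j => hΨsurj (Matrix.single i j 1)
  -- `A = J · Y(m₀)`
  let A : Matrix (Fin 2) (Fin 2) (ZMod 2) := !![B m₀ (pre 1 0), B m₀ (pre 1 1); B m₀ (pre 0 0), B m₀ (pre 0 1)]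
  -- the parametrisation of `A · Sym₂(𝔽₂)` by `𝔽₂³`
  let f : ZMod 2 × ZMod 2 × ZMod 2 → Matrix (Fin 2) (Fin 2) (ZMod 2) :=
    fun p => A * !![p.1, p.2.1; p.2.1, p.2.2]
  have hM₀U : M₀ ⊆ U := by
    intro x hx
    obtain ⟨τ, hτU, -, -, rfl⟩ := hM₀ x hx
    exact hτU m₀
  -- §3 ⟹ `Ψ(M₀) ⊆ range f`
  have hsub : Ψ '' M₀ ⊆ Set.range f := by
    rintro _ ⟨x, hx, rfl⟩
    obtain ⟨τ, hτU, hτadj, hτπ, rfl⟩ := hM₀ x hx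
    obtain ⟨S, hS, hrepr⟩ := exists_isSymm_socleMatrix π ρ hgs hgt U hπU Ψ hΨinj hΨπ pre hpreU hpre B hB hBsymm
      hBπ τ hτU hτadj hτπ
    refine ⟨(S 0 0, S 0 1, S 1 1), ?_⟩
    have h10 : S 1 0 = S 0 1 := hS.apply 0 1
    ext i l
    fin_cases i <;> fin_cases l <;>
      simp only [f, A, Matrix.mul_apply, Fin.sum_univ_two, of_apply, cons_val', cons_val_zero, cons_val_one,
        empty_val', cons_val_fin_one, Fin.isValue, Fin.zero_eta, Fin.mk_one, (hrepr m₀ _).1, (hrepr m₀ _).2, h10]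
  -- counting: `#Ψ(M₀) = 8 ≥ #range f`
  have hinjΨ : Set.InjOn Ψ M₀ := fun x hx y hy h => eq_of_map_eq U Ψ hΨinj (hM₀U hx) (hM₀U hy) h
  have hcardΨ : (Ψ '' M₀).ncard = 8 := by rw [hinjΨ.ncard_image, hcard]
  have hcard3 : (Set.univ : Set (ZMod 2 × ZMod 2 × ZMod 2)).ncard = 8 := by
    rw [Set.ncard_univ, Nat.card_eq_fintype_card]; rfl
  have hrange : Set.range f = f '' Set.univ := Set.image_univ.symm
  have hle : (Set.range f).ncard ≤ 8 := by
    rw [hrange, ← hcard3]; exact Set.ncard_image_le Set.finite_univ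
  have heq : Ψ '' M₀ = Set.range f :=
    Set.eq_of_subset_of_ncard_le hsub (by rw [hcardΨ]; exact hle) (Set.finite_range f)
  have hinjf : Function.Injective f := by
    have h8 : (f '' Set.univ).ncard = (Set.univ : Set (ZMod 2 × ZMod 2 × ZMod 2)).ncard := by
      rw [← hrange, ← heq, hcardΨ, hcard3]
    exact Set.injOn_univ.mp (Set.injOn_of_ncard_image_eq h8 Set.finite_univ)
  -- the symmetric square `w·wᵀ` in the parametrisation
  have hsq : ∀ w : Fin 2 → ZMod 2, f (w 0 * w 0, w 0 * w 1, w 1 * w 1) = A * vecMulVec w w := by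
    intro w
    simp only [f]
    congr 1
    ext i j
    fin_cases i <;> fin_cases j <;> simp [vecMulVec_apply, mul_comm]
  have hf0 : f 0 = 0 := by
    simp only [f, Prod.fst_zero, Prod.snd_zero]
    ext i j
    fin_cases i <;> fin_cases j <;> simp [Matrix.mul_apply]
  -- `A` is invertible
  obtain ⟨A', hAA', hA'A⟩ : ∃ A' : Matrix (Fin 2) (Fin 2) (ZMod 2), A * A' = 1 ∧ A' * A = 1 := by
    rcases exists_mulVec_eq_zero_or_exists_inverse A with ⟨w, hw, hAw⟩ | h
    · exfalso
      apply hw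
      have h0 : f (w 0 * w 0, w 0 * w 1, w 1 * w 1) = f 0 := by
        rw [hsq, hf0, Matrix.mul_vecMulVec, hAw]
        ext i j
        simp [vecMulVec_apply]
      have h1 := hinjf h0
      simp only [Prod.ext_iff, Prod.fst_zero, Prod.snd_zero] at h1
      have sq : ∀ x : ZMod 2, x * x = 0 → x = 0 := by decide
      ext i
      fin_cases i
      · exact sq _ h1.1
      · exact sq _ h1.2.2
    · exact h
  refine ⟨A, A', hAA', hA'A, fun u hu a w hw hΨu => ?_⟩
  constructor
  · -- `u ∈ M₀ ⟹ a·wᵀ = A·S`, `S` symmetric ⟹ `(A'a)·wᵀ` symmetric ⟹ `A'a ∈ {0, w}`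
    intro huM
    have hmem : Ψ u ∈ Set.range f := heq ▸ ⟨u, huM, rfl⟩
    obtain ⟨p, hp⟩ := hmem
    have hsymm : (vecMulVec (A' *ᵥ a) w).IsSymm := by
      rw [← Matrix.mul_vecMulVec, ← hΨu, ← hp]
      simp only [f, ← mul_assoc, hA'A, one_mul]
      refine Matrix.IsSymm.ext fun i j => ?_
      fin_cases i <;> fin_cases j <;> rfl
    have key := (Summit.BirchSwinnertonDyer.Rank1Residual.F1Sign2.vecMulVec_isSymm_iff_fin_two (A' *ᵥ a) w hw).mp hsymm
    have ha : a = A *ᵥ (A' *ᵥ a) := by rw [Matrix.mulVec_mulVec, hAA', Matrix.one_mulVec]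
    rcases key with h0 | h1
    · left
      rw [ha, h0, Matrix.mulVec_zero]
    · right
      rw [ha, h1]
  · -- `a ∈ {0, A w}` ⟹ `Ψ u ∈ A · Sym₂ = Ψ(M₀)` ⟹ `u ∈ M₀` (injectivity on `U`)
    intro ha
    have hmem : Ψ u ∈ Set.range f := by
      rcases ha with rfl | rfl
      · refine ⟨0, ?_⟩
        rw [hf0, hΨu]
        ext i j
        simp [vecMulVec_apply]
      · exact ⟨_, by rw [hsq, Matrix.mul_vecMulVec, hΨu]⟩
    rw [← heq] at hmem
    obtain ⟨x, hxM, hx⟩ := hmem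
    rwa [← eq_of_map_eq U Ψ hΨinj (hM₀U hxM) hu hx]

end Main

/-! ## §5 Copies: Schur for `ρ̄`, and «ALIGNED AT 2 ⟺ SAME COPY» in abstract form -/

section Copies

variable {V : Type*} [AddCommGroup V] [Module (ZMod 2) V] {G : Type*} [Group G]

/-- Schur for `ρ̄` in coordinates: a `π/ρ`-equivariant linear map `ψ : 𝔽₂² → U` reads, through `Ψ`, as `a ↦ a·wᵀ` for ONE
vector `w` (the copy `ρ̄ ⊗ w`): the shear fixes `e₀`, so `Ψ(ψ e₀)` has zero second row; the swap moves `e₀` to `e₁`. [folklore] -/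
theorem exists_forall_map_eq_vecMulVec (π : Representation (ZMod 2) G V) (ρ : G →* Matrix (Fin 2) (Fin 2) (ZMod 2))
    {gs gt : G} (hgs : ρ gs = !![0, 1; 1, 0]) (hgt : ρ gt = !![1, 1; 0, 1])
    (U : Submodule (ZMod 2) V) (Ψ : V →ₗ[ZMod 2] Matrix (Fin 2) (Fin 2) (ZMod 2))
    (hΨπ : ∀ g, ∀ u ∈ U, Ψ (π g u) = ρ g * Ψ u)
    (ψ : (Fin 2 → ZMod 2) →ₗ[ZMod 2] V) (hψU : ∀ a, ψ a ∈ U) (hψπ : ∀ g a, ψ (ρ g *ᵥ a) = π g (ψ a)) :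
    ∃ w : Fin 2 → ZMod 2, ∀ a, Ψ (ψ a) = vecMulVec a w := by
  -- `P := Ψ (ψ e₀)`; the shear fixes `e₀`
  have hte : (!![1, 1; 0, 1] : Matrix (Fin 2) (Fin 2) (ZMod 2)) *ᵥ Pi.single 0 1 = Pi.single 0 1 := by
    ext i; fin_cases i <;> simp [mulVec, dotProduct, Fin.sum_univ_two]
  have hse : (!![0, 1; 1, 0] : Matrix (Fin 2) (Fin 2) (ZMod 2)) *ᵥ Pi.single 0 1 = Pi.single 1 1 := by
    ext i; fin_cases i <;> simp [mulVec, dotProduct, Fin.sum_univ_two]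
  have hrow : ∀ l, Ψ (ψ (Pi.single 0 1)) 1 l = 0 := by
    intro l
    have h := congr_arg (fun a => Ψ (ψ a)) hte
    simp only at h
    rw [← hgt, hψπ, hΨπ _ _ (hψU _), hgt] at h
    have e := congrFun (congrFun h 0) l
    simp only [Matrix.mul_apply, Fin.sum_univ_two, of_apply, cons_val', cons_val_zero, cons_val_one, empty_val',
      cons_val_fin_one, one_mul, Fin.isValue] at e
    simpa using e
  have hswap : Ψ (ψ (Pi.single 1 1)) = !![0, 1; 1, 0] * Ψ (ψ (Pi.single 0 1)) := by
    rw [← hse, ← hgs, hψπ, hΨπ _ _ (hψU _)]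
  refine ⟨fun l => Ψ (ψ (Pi.single 0 1)) 0 l, fun a => ?_⟩
  have ha : a = a 0 • (Pi.single 0 1 : Fin 2 → ZMod 2) + a 1 • Pi.single 1 1 := by
    ext i; fin_cases i <;> simp
  rw [ha, map_add, map_smul, map_smul, map_add, map_smul, map_smul, hswap]
  ext i l
  fin_cases i <;>
    simp only [Matrix.add_apply, Matrix.smul_apply, smul_eq_mul, Matrix.mul_apply, Fin.sum_univ_two, of_apply,
      cons_val', cons_val_zero, cons_val_one, empty_val', cons_val_fin_one, vecMulVec_apply, hrow, Fin.isValue,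
      Fin.zero_eta, Fin.mk_one, Pi.add_apply, Pi.smul_apply, Pi.single_eq_same,
      Pi.single_eq_of_ne (by decide : (0 : Fin 2) ≠ 1), Pi.single_eq_of_ne (by decide : (1 : Fin 2) ≠ 0),
      mul_one, mul_zero, add_zero, zero_add, zero_mul, one_mul]

/-- **«ALIGNED AT 2 ⟺ SAME COPY» (abstract `F1Sign2.CopyAlignmentAtTwo`).** In the setting of
`exists_forall_mem_iff_eq_zero_or_eq_mulVec`, let two copies be given by `π/ρ`-equivariant linear embeddings
`ψ₁, ψ₂ : 𝔽₂² → U` (plays `Eᵢ[2] ≅ ρ̄ ↪ J₀(N)[𝔪]`, the common coordinates `𝔽₂² = ρ̄` being the unique equivariant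
identification `E₁[2] ≅ E₂[2]`), with CANONICAL vectors `cᵢ ≠ 0`, `ψᵢ cᵢ ∈ M₀` (plays (W0): the canonical subgroup
`C_{Eᵢ} = Eᵢ[2]⁰` lands in the multiplicative part). Then the two copies COINCIDE iff `c₁ = c₂`, i.e. iff the
identification is ALIGNED AT 2. This is the deduction `CopyAlignmentAtTwo ⟸ MULT2 + (W0) + (W1) + (W3)` of MEMO-imc §10.24,
kernel-checked; BSD is not proved by it and crux C1 is not closed by it. [folklore] -/
theorem range_eq_range_iff_eq_of_mem [FiniteDimensional (ZMod 2) V] (π : Representation (ZMod 2) G V)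
    (ρ : G →* Matrix (Fin 2) (Fin 2) (ZMod 2)) {gs gt : G} (hgs : ρ gs = !![0, 1; 1, 0]) (hgt : ρ gt = !![1, 1; 0, 1])
    (U : Submodule (ZMod 2) V) (hπU : ∀ g, ∀ u ∈ U, π g u ∈ U)
    (Ψ : V →ₗ[ZMod 2] Matrix (Fin 2) (Fin 2) (ZMod 2)) (hΨinj : ∀ u ∈ U, Ψ u = 0 → u = 0)
    (hΨsurj : ∀ X, ∃ u ∈ U, Ψ u = X) (hΨπ : ∀ g, ∀ u ∈ U, Ψ (π g u) = ρ g * Ψ u)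
    (B : LinearMap.BilinForm (ZMod 2) V) (hB : B.Nondegenerate) (hBsymm : ∀ x y, B x y = B y x)
    (hBπ : ∀ g x y, B (π g x) (π g y) = B x y)
    (M₀ : Set V) (m₀ : V) (hcard : M₀.ncard = 8)
    (hM₀ : ∀ x ∈ M₀, ∃ τ : V →ₗ[ZMod 2] V, (∀ v, τ v ∈ U) ∧ (∀ x y, B (τ x) y = B x (τ y)) ∧
      (∀ g v, τ (π g v) = π g (τ v)) ∧ τ m₀ = x)
    (ψ₁ ψ₂ : (Fin 2 → ZMod 2) →ₗ[ZMod 2] V) (hψU₁ : ∀ a, ψ₁ a ∈ U) (hψU₂ : ∀ a, ψ₂ a ∈ U)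
    (hψπ₁ : ∀ g a, ψ₁ (ρ g *ᵥ a) = π g (ψ₁ a)) (hψπ₂ : ∀ g a, ψ₂ (ρ g *ᵥ a) = π g (ψ₂ a))
    (hψinj₁ : ∀ a, ψ₁ a = 0 → a = 0) (hψinj₂ : ∀ a, ψ₂ a = 0 → a = 0)
    {c₁ c₂ : Fin 2 → ZMod 2} (hc₁ : c₁ ≠ 0) (hc₂ : c₂ ≠ 0) (hcM₁ : ψ₁ c₁ ∈ M₀) (hcM₂ : ψ₂ c₂ ∈ M₀) :
    Set.range ψ₁ = Set.range ψ₂ ↔ c₁ = c₂ := by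
  obtain ⟨A, A', hAA', hA'A, hmain⟩ := exists_forall_mem_iff_eq_zero_or_eq_mulVec π ρ hgs hgt U hπU Ψ hΨinj hΨsurj
    hΨπ B hB hBsymm hBπ M₀ m₀ hcard hM₀
  obtain ⟨w₁, hw₁⟩ := exists_forall_map_eq_vecMulVec π ρ hgs hgt U Ψ hΨπ ψ₁ hψU₁ hψπ₁
  obtain ⟨w₂, hw₂⟩ := exists_forall_map_eq_vecMulVec π ρ hgs hgt U Ψ hΨπ ψ₂ hψU₂ hψπ₂
  -- the copies are genuine planes: `wᵢ ≠ 0`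
  have hw₁0 : w₁ ≠ 0 := by
    rintro rfl
    refine hc₁ (hψinj₁ c₁ (hΨinj _ (hψU₁ c₁) ?_))
    rw [hw₁]; ext i j; simp [vecMulVec_apply]
  have hw₂0 : w₂ ≠ 0 := by
    rintro rfl
    refine hc₂ (hψinj₂ c₂ (hΨinj _ (hψU₂ c₂) ?_))
    rw [hw₂]; ext i j; simp [vecMulVec_apply]
  -- the canonical vectors are the multiplicative lines: `cᵢ = A wᵢ`
  have hc₁A : c₁ = A *ᵥ w₁ :=
    ((hmain _ (hψU₁ c₁) c₁ w₁ hw₁0 (hw₁ c₁)).mp hcM₁).resolve_left hc₁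
  have hc₂A : c₂ = A *ᵥ w₂ :=
    ((hmain _ (hψU₂ c₂) c₂ w₂ hw₂0 (hw₂ c₂)).mp hcM₂).resolve_left hc₂
  constructor
  · -- same copy ⟹ `w₁ = w₂` ⟹ same line ⟹ `c₁ = c₂`
    intro hr
    have h1 : ψ₁ c₁ ∈ Set.range ψ₂ := hr ▸ ⟨c₁, rfl⟩
    obtain ⟨a', ha'⟩ := h1
    have hmat : vecMulVec c₁ w₁ = vecMulVec a' w₂ := by rw [← hw₁, ← hw₂, ha']
    have hw : w₁ = w₂ := eq_of_vecMulVec_eq_vecMulVec c₁ a' w₁ w₂ hc₁ hw₁0 hmat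
    rw [hc₁A, hc₂A, hw]
  · -- `c₁ = c₂` ⟹ `A w₁ = A w₂` ⟹ `w₁ = w₂` ⟹ `Ψ ∘ ψ₁ = Ψ ∘ ψ₂` ⟹ `ψ₁ = ψ₂`
    intro hc
    have hw : w₁ = w₂ := by
      have h := congr_arg (fun x => A' *ᵥ x) (hc₁A.symm.trans (hc.trans hc₂A))
      simpa only [Matrix.mulVec_mulVec, hA'A, Matrix.one_mulVec] using h
    have hψ : ∀ a, ψ₁ a = ψ₂ a := fun a =>
      eq_of_map_eq U Ψ hΨinj (hψU₁ a) (hψU₂ a) (by rw [hw₁, hw₂, hw])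
    ext x
    constructor
    · rintro ⟨a, rfl⟩; exact ⟨a, (hψ a).symm⟩
    · rintro ⟨a, rfl⟩; exact ⟨a, hψ a⟩

/-- Each copy meets the multiplicative part in EXACTLY ONE LINE: there is a unique non-zero `a ∈ 𝔽₂²` with `ψ a ∈ M₀`
(namely `a = A w`). [folklore] -/
theorem existsUnique_ne_zero_and_mem [FiniteDimensional (ZMod 2) V] (π : Representation (ZMod 2) G V)
    (ρ : G →* Matrix (Fin 2) (Fin 2) (ZMod 2)) {gs gt : G} (hgs : ρ gs = !![0, 1; 1, 0]) (hgt : ρ gt = !![1, 1; 0, 1])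
    (U : Submodule (ZMod 2) V) (hπU : ∀ g, ∀ u ∈ U, π g u ∈ U)
    (Ψ : V →ₗ[ZMod 2] Matrix (Fin 2) (Fin 2) (ZMod 2)) (hΨinj : ∀ u ∈ U, Ψ u = 0 → u = 0)
    (hΨsurj : ∀ X, ∃ u ∈ U, Ψ u = X) (hΨπ : ∀ g, ∀ u ∈ U, Ψ (π g u) = ρ g * Ψ u)
    (B : LinearMap.BilinForm (ZMod 2) V) (hB : B.Nondegenerate) (hBsymm : ∀ x y, B x y = B y x)
    (hBπ : ∀ g x y, B (π g x) (π g y) = B x y)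
    (M₀ : Set V) (m₀ : V) (hcard : M₀.ncard = 8)
    (hM₀ : ∀ x ∈ M₀, ∃ τ : V →ₗ[ZMod 2] V, (∀ v, τ v ∈ U) ∧ (∀ x y, B (τ x) y = B x (τ y)) ∧
      (∀ g v, τ (π g v) = π g (τ v)) ∧ τ m₀ = x)
    (ψ : (Fin 2 → ZMod 2) →ₗ[ZMod 2] V) (hψU : ∀ a, ψ a ∈ U) (hψπ : ∀ g a, ψ (ρ g *ᵥ a) = π g (ψ a))
    (hψinj : ∀ a, ψ a = 0 → a = 0) :
    ∃! a : Fin 2 → ZMod 2, a ≠ 0 ∧ ψ a ∈ M₀ := by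
  obtain ⟨A, A', hAA', hA'A, hmain⟩ := exists_forall_mem_iff_eq_zero_or_eq_mulVec π ρ hgs hgt U hπU Ψ hΨinj hΨsurj
    hΨπ B hB hBsymm hBπ M₀ m₀ hcard hM₀
  obtain ⟨w, hw⟩ := exists_forall_map_eq_vecMulVec π ρ hgs hgt U Ψ hΨπ ψ hψU hψπ
  have hw0 : w ≠ 0 := by
    rintro rfl
    have h1 : (Pi.single 0 1 : Fin 2 → ZMod 2) = 0 := by
      refine hψinj _ (hΨinj _ (hψU _) ?_)
      rw [hw]; ext i j; simp [vecMulVec_apply]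
    exact (one_ne_zero (α := ZMod 2)) (by simpa using congrFun h1 0)
  have hAw : A *ᵥ w ≠ 0 := by
    intro h
    apply hw0
    have h' := congr_arg (fun x => A' *ᵥ x) h
    simpa only [Matrix.mulVec_mulVec, hA'A, Matrix.one_mulVec, Matrix.mulVec_zero] using h'
  refine ⟨A *ᵥ w, ⟨hAw, (hmain _ (hψU _) _ w hw0 (hw _)).mpr (Or.inr rfl)⟩, ?_⟩
  rintro a ⟨ha0, haM⟩
  exact ((hmain _ (hψU a) a w hw0 (hw a)).mp haM).resolve_left ha0

end Copies

end Summit.BirchSwinnertonDyer.BirchSwinnertonDyer.Theorems.AlignedTransportAtTwoKilfordCopyMultiplicativeLine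

end
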